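import Summits.CriticalPhenomena.PercolationContinuityZ3.Theorems.PercNearOneGluingNoHeavyPcintBSMRRows
import HarnessLib

/-!
# PCINT lane, PHASE 9 (block renewal with reach-`m` pieces): chunk term data from literal short tables

Cell `prim-pcint`, seat `prim-pcint-1` (gen 17); memo `run/shared/lean/prim/pcint/T-FIBRE-ROUTE.md` §PHASE 9.

Kernel measurements (gen 17): recomputing the windowed rows inside every Green-table check dominates the cost of the
reach-3 instances.  Here the short tables of the even rows of a chunk (`BSMR.shortsFrom`, exactly the tables inside
`BSMR.termsFrom`) are meant to be supplied as a literal `SH` checked ONCE (`SH = shortsFrom …` by `decide`), after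
which the chunk term data are read off the literal (**`BSMR.termsLit`**, **`BSMR.termsFrom_eq_termsLit`**) and every
Green-table check is a cheap table sum.
-/

namespace Summit.CriticalPhenomena.PercolationContinuityZ3.Theorems.Pcint.BSMR

open Summit.CriticalPhenomena.PercolationContinuityZ3.Theorems.Pcint.BSMX

/-- The short tables (on `[-Dd, Dd]`) of the rows `2j`, `j < L`, continued from a start row. -/
def shortsFrom (m : ℕ) (A : List ℕ) (DA D : ℕ) (start : List ℕ) (W Dd L : ℕ) : List (List ℕ) :=
  let rs := hrowsFrom m A DA D start (2 * L)
  List.ofFn fun j : Fin L => hvals (rs.getD (2 * j) []) W Dd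

/-- Chunk term data read off literal short tables: `(Wc_{i₀+j}, SH_j)`, `j < L`. -/
def termsLit (Wc : List ℕ) (i₀ : ℕ) (SH : List (List ℕ)) (L : ℕ) : List (ℕ × List ℕ) :=
  List.ofFn fun j : Fin L => (Wc.getD (i₀ + j) 0, SH.getD j [])

/-- **The chunk term data from checked literal short tables.** -/
theorem termsFrom_eq_termsLit {m : ℕ} {A : List ℕ} {DA D : ℕ} {start : List ℕ} {W Dd L : ℕ} {SH : List (List ℕ)}
    (h : SH = shortsFrom m A DA D start W Dd L) (i₀ : ℕ) (Wc : List ℕ) :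
    termsFrom m A DA D start W Dd L i₀ Wc = termsLit Wc i₀ SH L := by
  subst h
  show (List.ofFn fun j : Fin L => (Wc.getD (i₀ + j) 0, hvals ((hrowsFrom m A DA D start (2 * L)).getD (2 * j) []) W Dd)) =
    List.ofFn fun j : Fin L => (Wc.getD (i₀ + j) 0,
      (List.ofFn fun j : Fin L => hvals ((hrowsFrom m A DA D start (2 * L)).getD (2 * j) []) W Dd).getD j [])
  congr 1
  funext j
  refine Prod.ext rfl ?_
  simp [List.getD_eq_getElem?_getD]

end Summit.CriticalPhenomena.PercolationContinuityZ3.Theorems.Pcint.BSMR
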